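import Summits.BirchSwinnertonDyer.BirchSwinnertonDyer.Theorems.CumulativeHeegnerLeopoldtCumulativeHeegnerInclusionAtThreeLayerControl
import Summits.BirchSwinnertonDyer.BirchSwinnertonDyer.Theorems.BiquadraticEisensteinDescentDefs
import Summits.BirchSwinnertonDyer.Rank1Residual.X11b.AnticyclotomicDualPair
import Literature.NumberTheory.EllipticCurves.IwasawaDualLayerCoinvariantsProofs
import Literature.RingTheory.FittingIdeal.Functoriality
import Summits.BirchSwinnertonDyer.BirchSwinnertonDyer.Theorems.ErratumRoadFiveBoundedCongruenceLimit
import HarnessLib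

/-!
# Crux K1 `CumulativeHeegnerInclusionAtThree` (stmt-BirchSwinnertonDyer-24198) / crux A (stmt-26896): the
# port [P-ctl], IV — the DUAL (`Λ`-module) packaging `X^Σ ⧸ ω_n X^Σ → Hom(Sel_𝔭^Σ(K_n, E[p^∞]), ℚ/ℤ)`

Width seat bsd-line-chl-k1-p1-w8 (`--supports stmt-BirchSwinnertonDyer-24198`). THEOREMS ONLY (no definition,
no named fact, no `sorry`); ROUTE-INDEPENDENT. Parts I–III (p648123, p648821, p649336) prove control at every
layer in the SELMER formulation (`s_n = res : Sel_𝔭^Σ(K_n) → Sel_𝔭^Σ(K_∞)[ω_n]` injective / onto). The layer-tower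
door of crux A (`…LayerTowerControl.forall_pow_mul_mem_map_fittingIdeal_sup_layer`, p637962) wants the DUAL form:
`Λ`-linear `q_n : X ⧸ ω_n X → N_n` onto a "layer-`n` Selmer dual" with controlled kernel, `X = XAc`,
`ω_n = (1+T)^{pⁿ} − 1`. Built here with NO new definition, for ANY presentation of the layer dual as the tree's
generic Iwasawa dual `LocNilDual Sel_n f h = Hom(Sel_n, ℚ/ℤ)` (BED Defs; `Sel_n = selmerOver (κ.layerSubgroup n) …`,
`f` any endomorphism agreeing with `conj_γ`, `h` any local-nilpotence witness) and ANY additive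
`u : Sel_n → Sel_𝔭^Σ(K_∞)` agreeing with `res_{K_n→K_∞}` (all canonical; a line's `Defs` file instantiates them):
§1 `isLocNil_layer` (`f − 1` IS `p`-locally-nilpotent: `Gal(\bar K/K_n)` compact, `f^{pⁿ} = conj_{γ^{pⁿ}} = id`);
§2 `exists_dualLayerMap` (`q_n [x] = x ∘ u`, `Λ`-linear, kills `ω_n X` by `IsDualPair.toDual_omega_smul`);
§3 `dualLayerMap_surjective_of_injective` (`s_n` injective ⟹ `q_n` onto, `ℚ/ℤ` injective),
`dualLayerMap_injective_of_forall_exists` (`s_n` onto `Sel[ω_n]` ⟹ `q_n` injective, `IsDualPair.exists_eq_smul_of_forall_ker`),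
`dualLayerMap_bijective_of_control` (**exact control ⟹ `X^Σ ⧸ ω_n X^Σ ≅ₗ[Λ] Hom(Sel_𝔭^Σ(K_n), ℚ/ℤ)`**, layer data with
`C_n = 0`) and `fittingIdeal_layer_le_sup_of_control` (`Fitt₀(Hom(Sel_𝔭^Σ(K_n), ℚ/ℤ)) ⊆ Fitt₀(X^Σ) + (ω_n)`);
§4 `fittingIdeal_XAc_le_empty` (`Σ`-passage: `Fitt₀(X^Σ) ⊆ Fitt₀(X^∅)`, `X^∅` being a quotient of `X^Σ`).
Nothing about Kolyvagin systems, `θ`-elements or `L`-functions is asserted; crux A (26896) and K1 (24198) stay OPEN;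
BSD is not proved by any of this; no summit statement is proved by this seat.
References: [GreenbergLNM1716] §1 pp. 60–62 (`X/θ_n X` dual to `Sel^{Γ_n}`), §3 p. 85; [Washington1997] §13.4;
[MazurTate1987] §1; [StacksProject] Tag 07ZA (3).
-/


set_option linter.dupNamespace false
set_option autoImplicit false

noncomputable section

open scoped Classical

namespace Summit.BirchSwinnertonDyer.BirchSwinnertonDyer.Theorems.CumulativeHeegnerInclusionAtThreeLayerControlDual

open NumberField IsDedekindDomain Field
open Literature.NumberTheory.EllipticCurves Literature.NumberTheory.EllipticCurves.GreenbergSelmer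
open Literature.NumberTheory.EllipticCurves.IwasawaDual
open Literature.NumberTheory.GaloisRepresentations
open Summit.BirchSwinnertonDyer.Rank1Residual.X11b Summit.BirchSwinnertonDyer.Rank1Residual.X11b.AcSelmer
open Summit.BirchSwinnertonDyer.BirchSwinnertonDyer.Theorems.CumulativeHeegnerInclusionAtThreeLayerControl
open Summit.BirchSwinnertonDyer.BirchSwinnertonDyer.Theorems.BiquadraticEisensteinDescentDefs
open Literature.RingTheory.FittingIdeal

variable {K : Type} [Field K] [NumberField K] {p : ℕ} [Fact p.Prime] (κ : ZpExtension K p)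
  (W : WeierstrassCurve K) (𝔭 : HeightOneSpectrum (𝓞 K)) (S : Set (HeightOneSpectrum (𝓞 K)))
  (γ : absoluteGaloisGroup K) (n : ℕ)

/-! ## §1 `conj_γ − 1` is `p`-locally-nilpotent on `Sel_𝔭^Σ(K_n, E[p^∞])` -/

/-- Powers of an endomorphism of `Sel_𝔭^Σ(K_n, E[p^∞])` agreeing with `conj_γ` agree with `conj_{γ^k}`. [folklore] -/
theorem coe_pow_apply_of_coe_eq
    (f : AddMonoid.End ↥(selmerOver (κ.layerSubgroup n) (W.geomPrimaryTorsion p) p 𝔭 S))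
    (hf : ∀ s, ((f s : selmerOver (κ.layerSubgroup n) (W.geomPrimaryTorsion p) p 𝔭 S) :
      W.subgroupH1 p (κ.layerSubgroup n)) = W.conjH1 p (κ.layerSubgroup n) γ s)
    (k : ℕ) (s : selmerOver (κ.layerSubgroup n) (W.geomPrimaryTorsion p) p 𝔭 S) :
    (((f ^ k) s : selmerOver (κ.layerSubgroup n) (W.geomPrimaryTorsion p) p 𝔭 S) :
        W.subgroupH1 p (κ.layerSubgroup n)) = W.conjH1 p (κ.layerSubgroup n) (γ ^ k) s := by
  induction k generalizing s with
  | zero => rw [pow_zero, pow_zero, AddMonoid.End.one_apply, W.conjH1_one_holds p (κ.layerSubgroup n),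
      AddMonoidHom.id_apply]
  | succ k ih =>
    rw [pow_succ, AddMonoid.End.coe_mul, Function.comp_apply, ih, hf, pow_succ,
      W.conjH1_mul_holds p (κ.layerSubgroup n), AddMonoidHom.comp_apply]

/-- **`conj_γ − 1` is `p`-locally-nilpotent on `Sel_𝔭^Σ(K_n, E[p^∞])`** for EVERY `γ ∈ Γ_K` (no topological-generator
hypothesis) and every endomorphism `f` of the layer Selmer group agreeing with `conj_γ`: every class is killed by
some `p^k` (`Gal(\bar K/K_n)` is compact — open in the profinite `Γ_K` — and `E[p^∞]` is discrete `p`-primary, tree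
`IwasawaDual.exists_pow_smul_oneCocycleClass_eq_zero`), and `f^{pⁿ} = conj_{γ^{pⁿ}}` is the IDENTITY on `H¹(K_n, ·)`
(`γ^{pⁿ} ∈ Gal(\bar K/K_n)`, inner automorphisms), so `(f − 1)^{k·pⁿ}` kills it
(`IwasawaDual.pow_mul_prime_pow_apply_eq_zero`). Hence `Hom(Sel_𝔭^Σ(K_n, E[p^∞]), ℚ/ℤ)` is a `Λ`-module, `1 + T ↦ conj_γ`
(`LocNilDual`). [cite: GreenbergLNM1716, §1 p. 60 (after Conj. 1.3)] -/
theorem isLocNil_layer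
    (f : AddMonoid.End ↥(selmerOver (κ.layerSubgroup n) (W.geomPrimaryTorsion p) p 𝔭 S))
    (hf : ∀ s, ((f s : selmerOver (κ.layerSubgroup n) (W.geomPrimaryTorsion p) p 𝔭 S) :
      W.subgroupH1 p (κ.layerSubgroup n)) = W.conjH1 p (κ.layerSubgroup n) γ s) :
    IsLocNil p (f - 1) := by
  have htor : ∀ s : selmerOver (κ.layerSubgroup n) (W.geomPrimaryTorsion p) p 𝔭 S,
      ∃ k : ℕ, p ^ k • s = 0 := fun s ↦ by
    haveI : CompactSpace (κ.layerSubgroup n) := isCompact_iff_compactSpace.mp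
      (Subgroup.isClosed_of_isOpen _ (κ.isOpen_layerSubgroup n)).isCompact
    have hc : ∃ k : ℕ, p ^ k • (s : W.subgroupH1 p (κ.layerSubgroup n)) = 0 := by
      obtain ⟨φ, hφ⟩ := oneCocycleClass_surjective _ (s : W.subgroupH1 p (κ.layerSubgroup n))
      rw [← hφ]
      exact IwasawaDual.exists_pow_smul_oneCocycleClass_eq_zero φ fun σ ↦ by
        obtain ⟨k, hk⟩ := (φ.1 σ).2
        exact ⟨k, Subtype.ext (by rw [AddSubgroupClass.coe_nsmul]; exact hk)⟩
    obtain ⟨k, hk⟩ := hc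
    exact ⟨k, Subtype.ext (by rw [AddSubgroupClass.coe_nsmul]; exact hk)⟩
  refine ⟨htor, fun s ↦ ?_⟩
  obtain ⟨k, hk⟩ := htor s
  have hφ : (f ^ p ^ n) s = s := by
    apply Subtype.ext
    have e1 := coe_pow_apply_of_coe_eq κ W 𝔭 S γ n f hf (p ^ n) s
    have e2 : W.conjH1 p (κ.layerSubgroup n) (γ ^ p ^ n) = AddMonoidHom.id _ :=
      conjH1_of_mem_holds (κ.layerSubgroup n) (W.geomPrimaryTorsion p)
        (CumulativeHeegnerInclusionAtThreeLayerControl.pow_prime_pow_mem_layerSubgroup κ γ n)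
    rw [e1, e2, AddMonoidHom.id_apply]
  exact ⟨k * p ^ n, IwasawaDual.pow_mul_prime_pow_apply_eq_zero (Fact.out : p.Prime) f n hφ hk⟩

/-! ## §2 The dual layer map `q_n : X ⧸ ω_n X → Hom(Sel_𝔭^Σ(K_n, E[p^∞]), ℚ/ℤ)` -/

section DualMap

variable [hγ : Fact (κ.IsTopGenerator γ)]

omit hγ in
/-- An additive `u : Sel_𝔭^Σ(K_n) → Sel_𝔭^Σ(K_∞)` agreeing with restriction intertwines `f` (agreeing with `conj_γ`
on `K_n`) and `conj_γ` on `K_∞` (`res ∘ conj_γ = conj_γ ∘ res`). [cite: GreenbergLNM1716, §3 p. 85] -/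
theorem conjSelmerAc_comp_eq
    (f : AddMonoid.End ↥(selmerOver (κ.layerSubgroup n) (W.geomPrimaryTorsion p) p 𝔭 S))
    (hf : ∀ s, ((f s : selmerOver (κ.layerSubgroup n) (W.geomPrimaryTorsion p) p 𝔭 S) :
      W.subgroupH1 p (κ.layerSubgroup n)) = W.conjH1 p (κ.layerSubgroup n) γ s)
    (u : ↥(selmerOver (κ.layerSubgroup n) (W.geomPrimaryTorsion p) p 𝔭 S) →+ ↥(selmerAc W p κ 𝔭 S))
    (hu : ∀ c, ((u c : selmerAc W p κ 𝔭 S) : W.subgroupH1 p κ.kerSubgroup) =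
      W.resOfLe p (κ.kerSubgroup_le_layerSubgroup n) c)
    (c : selmerOver (κ.layerSubgroup n) (W.geomPrimaryTorsion p) p 𝔭 S) :
    conjSelmerAc W p κ 𝔭 S γ (u c) = u (f c) := by
  apply Subtype.ext
  rw [coe_conjSelmerAc_apply, hu, hu, hf]
  show conjH1 κ.kerSubgroup (W.geomPrimaryTorsion p) γ
      (resOfLe (W.geomPrimaryTorsion p) (κ.kerSubgroup_le_layerSubgroup n) c) =
    resOfLe (W.geomPrimaryTorsion p) (κ.kerSubgroup_le_layerSubgroup n)
      (conjH1 (κ.layerSubgroup n) (W.geomPrimaryTorsion p) γ c)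
  rw [← AddMonoidHom.comp_apply,
    ← resOfLe_comp_conjH1_holds (M := W.geomPrimaryTorsion p) (κ.kerSubgroup_le_layerSubgroup n) γ,
    AddMonoidHom.comp_apply]

omit hγ in
/-- The image of such a `u` is fixed by `(conj_γ)^{pⁿ}` (it consists of classes restricted from `K_n`).
[cite: GreenbergLNM1716, §3 p. 85 ("the image of `h_n` is contained in the `Γ_n`-invariants")] -/
theorem conjSelmerAc_pow_apply_eq
    (u : ↥(selmerOver (κ.layerSubgroup n) (W.geomPrimaryTorsion p) p 𝔭 S) →+ ↥(selmerAc W p κ 𝔭 S))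
    (hu : ∀ c, ((u c : selmerAc W p κ 𝔭 S) : W.subgroupH1 p κ.kerSubgroup) =
      W.resOfLe p (κ.kerSubgroup_le_layerSubgroup n) c)
    (c : selmerOver (κ.layerSubgroup n) (W.geomPrimaryTorsion p) p 𝔭 S) :
    ((conjSelmerAc W p κ 𝔭 S γ) ^ p ^ n) (u c) = u c := by
  apply Subtype.ext
  rw [coe_conjSelmerAc_pow_apply, hu]
  exact conjH1_pow_resOfLe_layer κ n γ (c : W.subgroupH1 p (κ.layerSubgroup n))

/-- **The dual layer map.** For a topological generator `γ` and ANY `(f, h, u)` as above (`f` agreeing with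
`conj_γ` on `Sel_n = Sel_𝔭^Σ(K_n, E[p^∞])`, `u` with `res_{K_n→K_∞}`): a `Λ`-LINEAR
`q_n : X_ac^Σ ⧸ ω_n X_ac^Σ → LocNilDual Sel_n f h = Hom(Sel_n, ℚ/ℤ)`, `q_n [x] = x ∘ u` (`x ↦ x ∘ u` is `Λ`-linear by
naturality of the canonical action; it kills `ω_n • x` since `(ω_n • x)(s) = x((conj_γ^{pⁿ} − 1) s)` and `im u ⊆ Sel[ω_n]`).
[cite: GreenbergLNM1716, §1 p. 62 and §3 p. 85] [cite: Washington1997, §13.4] -/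
theorem exists_dualLayerMap
    (f : AddMonoid.End ↥(selmerOver (κ.layerSubgroup n) (W.geomPrimaryTorsion p) p 𝔭 S))
    (hf : ∀ s, ((f s : selmerOver (κ.layerSubgroup n) (W.geomPrimaryTorsion p) p 𝔭 S) :
      W.subgroupH1 p (κ.layerSubgroup n)) = W.conjH1 p (κ.layerSubgroup n) γ s)
    (h : IsLocNil p (f - 1))
    (u : ↥(selmerOver (κ.layerSubgroup n) (W.geomPrimaryTorsion p) p 𝔭 S) →+ ↥(selmerAc W p κ 𝔭 S))
    (hu : ∀ c, ((u c : selmerAc W p κ 𝔭 S) : W.subgroupH1 p κ.kerSubgroup) =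
      W.resOfLe p (κ.kerSubgroup_le_layerSubgroup n) c) :
    ∃ q : (XAc W p κ 𝔭 S γ ⧸ (Ideal.span {((1 + PowerSeries.X : IwasawaAlgebra p) ^ (p ^ n) - 1)} •
        (⊤ : Submodule (IwasawaAlgebra p) (XAc W p κ 𝔭 S γ)))) →ₗ[IwasawaAlgebra p]
        LocNilDual (selmerOver (κ.layerSubgroup n) (W.geomPrimaryTorsion p) p 𝔭 S) f h,
      ∀ (x : XAc W p κ 𝔭 S γ) (c : selmerOver (κ.layerSubgroup n) (W.geomPrimaryTorsion p) p 𝔭 S),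
        q (Submodule.Quotient.mk x) c = x (u c) := by
  -- the `Λ`-linear restriction of characters `X_ac^Σ = Hom(Sel_∞, ℚ/ℤ) → Hom(Sel_n, ℚ/ℤ)` along `u`
  have hu' : ∀ c, (conjSelmerAc W p κ 𝔭 S γ - 1) (u c) = u ((f - 1) c) := fun c ↦ by
    rw [IwasawaDual.End_sub_apply, IwasawaDual.End_sub_apply, AddMonoid.End.one_apply,
      AddMonoid.End.one_apply, map_sub, conjSelmerAc_comp_eq κ W 𝔭 S γ n f hf u hu c]
  let R : XAc W p κ 𝔭 S γ →ₗ[IwasawaAlgebra p]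
      LocNilDual (selmerOver (κ.layerSubgroup n) (W.geomPrimaryTorsion p) p 𝔭 S) f h :=
    { toFun := fun x ↦ (show selmerAc W p κ 𝔭 S →+ AddCircle (1 : ℚ) from x).comp u
      map_add' := fun _ _ ↦ rfl
      map_smul' := fun F x ↦ by
        change ((isLocNil_conjSelmerAc_sub_one W p κ 𝔭 S hγ.out).smulFun F
            (show selmerAc W p κ 𝔭 S →+ AddCircle (1 : ℚ) from x)).comp u =
          h.smulFun F ((show selmerAc W p κ 𝔭 S →+ AddCircle (1 : ℚ) from x).comp u)
        exact Summit.BirchSwinnertonDyer.Rank1Residual.X2.DualRestriction.smulFun_comp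
          (isLocNil_conjSelmerAc_sub_one W p κ 𝔭 S hγ.out) h u hu' F _ }
  have hR : ∀ (x : XAc W p κ 𝔭 S γ) (c : selmerOver (κ.layerSubgroup n) (W.geomPrimaryTorsion p) p 𝔭 S),
      R x c = x (u c) := fun _ _ ↦ rfl
  -- `ω_n • x` dies
  have hω : (Ideal.span {((1 + PowerSeries.X : IwasawaAlgebra p) ^ (p ^ n) - 1)} •
      (⊤ : Submodule (IwasawaAlgebra p) (XAc W p κ 𝔭 S γ))) ≤ LinearMap.ker R := by
    rw [Submodule.smul_le]
    intro r hr x _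
    obtain ⟨a, rfl⟩ := Ideal.mem_span_singleton'.mp hr
    rw [LinearMap.mem_ker, mul_smul, map_smul]
    suffices h0 : R ((((1 + PowerSeries.X : IwasawaAlgebra p) ^ (p ^ n) - 1)) • x) = 0 by
      rw [h0, smul_zero]
    refine LocNilDual.ext h fun c ↦ ?_
    change ((((1 + PowerSeries.X : IwasawaAlgebra p) ^ (p ^ n) - 1)) • x) (u c) = 0
    have e : ((((1 + PowerSeries.X : IwasawaAlgebra p) ^ (p ^ n) - 1)) • x) (u c) =
        x (((conjSelmerAc W p κ 𝔭 S γ) ^ (p ^ n) - 1) (u c)) :=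
      (XAc.isDualPair W p κ 𝔭 S γ).toDual_omega_smul n x (u c)
    rw [e, IwasawaDual.End_sub_apply, AddMonoid.End.one_apply, conjSelmerAc_pow_apply_eq κ W 𝔭 S γ n u hu,
      sub_self, map_zero]
  exact ⟨Submodule.liftQ _ R hω, fun x c ↦ by rw [Submodule.liftQ_apply]; exact hR x c⟩

/-! ## §3 `q_n` is onto when `s_n` is injective, injective when `s_n` is onto `Sel[ω_n]` -/

omit hγ in
/-- Such a `u` is injective when `res_{K_n→K_∞}` is (e.g. `E(K_∞)[p^∞] = 0`, I/II). [folklore] -/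
theorem injective_of_coe_eq
    (u : ↥(selmerOver (κ.layerSubgroup n) (W.geomPrimaryTorsion p) p 𝔭 S) →+ ↥(selmerAc W p κ 𝔭 S))
    (hu : ∀ c, ((u c : selmerAc W p κ 𝔭 S) : W.subgroupH1 p κ.kerSubgroup) =
      W.resOfLe p (κ.kerSubgroup_le_layerSubgroup n) c)
    (hinj : Function.Injective (W.resOfLe p (κ.kerSubgroup_le_layerSubgroup n))) :
    Function.Injective u := fun c c' hcc' ↦ by
  apply Subtype.ext
  apply hinj
  rw [← hu, ← hu, hcc']

/-- **`s_n` injective ⟹ `q_n` SURJECTIVE** (characters extend along the injective `u`: `ℚ/ℤ` is divisible,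
Mathlib `CharacterModule.dual_surjective_of_injective`), for ANY `q` with the defining property. [cite: GreenbergLNM1716, §1 p. 60] -/
theorem dualLayerMap_surjective_of_injective
    {f : AddMonoid.End ↥(selmerOver (κ.layerSubgroup n) (W.geomPrimaryTorsion p) p 𝔭 S)}
    {h : IsLocNil p (f - 1)}
    (u : ↥(selmerOver (κ.layerSubgroup n) (W.geomPrimaryTorsion p) p 𝔭 S) →+ ↥(selmerAc W p κ 𝔭 S))
    (hu : ∀ c, ((u c : selmerAc W p κ 𝔭 S) : W.subgroupH1 p κ.kerSubgroup) =
      W.resOfLe p (κ.kerSubgroup_le_layerSubgroup n) c)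
    (q : (XAc W p κ 𝔭 S γ ⧸ (Ideal.span {((1 + PowerSeries.X : IwasawaAlgebra p) ^ (p ^ n) - 1)} •
        (⊤ : Submodule (IwasawaAlgebra p) (XAc W p κ 𝔭 S γ)))) →ₗ[IwasawaAlgebra p]
        LocNilDual (selmerOver (κ.layerSubgroup n) (W.geomPrimaryTorsion p) p 𝔭 S) f h)
    (hq : ∀ (x : XAc W p κ 𝔭 S γ) (c : selmerOver (κ.layerSubgroup n) (W.geomPrimaryTorsion p) p 𝔭 S),
      q (Submodule.Quotient.mk x) c = x (u c))
    (hinj : Function.Injective (W.resOfLe p (κ.kerSubgroup_le_layerSubgroup n))) :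
    Function.Surjective q := by
  intro y
  obtain ⟨χ, hχ⟩ := CharacterModule.dual_surjective_of_injective u.toIntLinearMap
    (injective_of_coe_eq κ W 𝔭 S n u hu hinj) (LocNilDual.toHom h y)
  refine ⟨Submodule.Quotient.mk (show XAc W p κ 𝔭 S γ from χ), LocNilDual.ext h fun c ↦ ?_⟩
  rw [hq]
  exact DFunLike.congr_fun hχ c

/-- **`s_n` onto `Sel[ω_n]` ⟹ `q_n` INJECTIVE**: if every `conj_{γ^{pⁿ}}`-fixed class of `Sel_𝔭^Σ(K_∞, E[p^∞])` comes
from `Sel_𝔭^Σ(K_n, E[p^∞])` (II/III), a character `x` with `x ∘ u = 0` kills `ker ((conj_γ)^{pⁿ} − 1)`, so `x ∈ ω_n X`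
(tree `IsDualPair.exists_eq_smul_of_forall_ker` + `toDual_omega_smul`). [cite: GreenbergLNM1716, §1 p. 62 (`X/θ_n X`)] -/
theorem dualLayerMap_injective_of_forall_exists
    {f : AddMonoid.End ↥(selmerOver (κ.layerSubgroup n) (W.geomPrimaryTorsion p) p 𝔭 S)}
    {h : IsLocNil p (f - 1)}
    (u : ↥(selmerOver (κ.layerSubgroup n) (W.geomPrimaryTorsion p) p 𝔭 S) →+ ↥(selmerAc W p κ 𝔭 S))
    (hu : ∀ c, ((u c : selmerAc W p κ 𝔭 S) : W.subgroupH1 p κ.kerSubgroup) =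
      W.resOfLe p (κ.kerSubgroup_le_layerSubgroup n) c)
    (q : (XAc W p κ 𝔭 S γ ⧸ (Ideal.span {((1 + PowerSeries.X : IwasawaAlgebra p) ^ (p ^ n) - 1)} •
        (⊤ : Submodule (IwasawaAlgebra p) (XAc W p κ 𝔭 S γ)))) →ₗ[IwasawaAlgebra p]
        LocNilDual (selmerOver (κ.layerSubgroup n) (W.geomPrimaryTorsion p) p 𝔭 S) f h)
    (hq : ∀ (x : XAc W p κ 𝔭 S γ) (c : selmerOver (κ.layerSubgroup n) (W.geomPrimaryTorsion p) p 𝔭 S),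
      q (Submodule.Quotient.mk x) c = x (u c))
    (hsurj : ∀ a ∈ selmerAc W p κ 𝔭 S, W.conjH1 p κ.kerSubgroup (γ ^ p ^ n) a = a →
      ∃ c ∈ selmerOver (κ.layerSubgroup n) (W.geomPrimaryTorsion p) p 𝔭 S,
        W.resOfLe p (κ.kerSubgroup_le_layerSubgroup n) c = a) :
    Function.Injective q := by
  rw [injective_iff_map_eq_zero]
  intro z hz
  obtain ⟨x, rfl⟩ := Submodule.Quotient.mk_surjective _ z
  -- `x` kills `ker ((conj_γ)^{pⁿ} − 1)`
  have hx : ∀ a : selmerAc W p κ 𝔭 S, ((conjSelmerAc W p κ 𝔭 S γ) ^ p ^ n - 1) a = 0 →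
      (AddMonoidHom.id (XAc W p κ 𝔭 S γ)) x a = 0 := by
    intro a ha
    show x a = 0
    rw [IwasawaDual.End_sub_apply, AddMonoid.End.one_apply, sub_eq_zero] at ha
    have ha' : W.conjH1 p κ.kerSubgroup (γ ^ p ^ n) (a : W.subgroupH1 p κ.kerSubgroup) = a := by
      rw [← coe_conjSelmerAc_pow_apply, ha]
    obtain ⟨c, hc, hca⟩ := hsurj a a.2 ha'
    have huc : u ⟨c, hc⟩ = a := Subtype.ext (by rw [hu]; exact hca)
    have h0 := hq x ⟨c, hc⟩
    rw [hz, huc] at h0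
    rw [← h0]
    rfl
  obtain ⟨y, hy⟩ := (XAc.isDualPair W p κ 𝔭 S γ).exists_eq_smul_of_forall_ker
    ((XAc.isDualPair W p κ 𝔭 S γ).toDual_omega_smul n) hx
  rw [hy]
  exact (Submodule.Quotient.mk_eq_zero _).mpr
    (Submodule.smul_mem_smul (Ideal.mem_span_singleton_self _) Submodule.mem_top)

/-- **Exact control at layer `n` ⟹ `X^Σ ⧸ ω_n X^Σ ≅ₗ[Λ] Hom(Sel_𝔭^Σ(K_n, E[p^∞]), ℚ/ℤ)`**: `s_n` injective and onto
the `conj_{γ^{pⁿ}}`-invariants (II `layerControl_of_bad_subset` / III `cell_layerControl_of_bad_subset`) ⟹ a BIJECTIVE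
`Λ`-linear `q_n` with `q_n [x] = x ∘ u` — the layer data of `…LayerTowerControl.forall_pow_mul_mem_map_fittingIdeal_sup_layer`
with `C_n = 0`. [cite: GreenbergLNM1716, §1 p. 62 and §3 p. 90] [cite: MazurTate1987, §1] -/
theorem dualLayerMap_bijective_of_control
    (f : AddMonoid.End ↥(selmerOver (κ.layerSubgroup n) (W.geomPrimaryTorsion p) p 𝔭 S))
    (hf : ∀ s, ((f s : selmerOver (κ.layerSubgroup n) (W.geomPrimaryTorsion p) p 𝔭 S) :
      W.subgroupH1 p (κ.layerSubgroup n)) = W.conjH1 p (κ.layerSubgroup n) γ s)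
    (h : IsLocNil p (f - 1))
    (u : ↥(selmerOver (κ.layerSubgroup n) (W.geomPrimaryTorsion p) p 𝔭 S) →+ ↥(selmerAc W p κ 𝔭 S))
    (hu : ∀ c, ((u c : selmerAc W p κ 𝔭 S) : W.subgroupH1 p κ.kerSubgroup) =
      W.resOfLe p (κ.kerSubgroup_le_layerSubgroup n) c)
    (hinj : Function.Injective (W.resOfLe p (κ.kerSubgroup_le_layerSubgroup n)))
    (hsurj : ∀ a ∈ selmerAc W p κ 𝔭 S, W.conjH1 p κ.kerSubgroup (γ ^ p ^ n) a = a →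
      ∃ c ∈ selmerOver (κ.layerSubgroup n) (W.geomPrimaryTorsion p) p 𝔭 S,
        W.resOfLe p (κ.kerSubgroup_le_layerSubgroup n) c = a) :
    ∃ q : (XAc W p κ 𝔭 S γ ⧸ (Ideal.span {((1 + PowerSeries.X : IwasawaAlgebra p) ^ (p ^ n) - 1)} •
        (⊤ : Submodule (IwasawaAlgebra p) (XAc W p κ 𝔭 S γ)))) →ₗ[IwasawaAlgebra p]
        LocNilDual (selmerOver (κ.layerSubgroup n) (W.geomPrimaryTorsion p) p 𝔭 S) f h,
      Function.Bijective q ∧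
        ∀ (x : XAc W p κ 𝔭 S γ) (c : selmerOver (κ.layerSubgroup n) (W.geomPrimaryTorsion p) p 𝔭 S),
          q (Submodule.Quotient.mk x) c = x (u c) := by
  obtain ⟨q, hq⟩ := exists_dualLayerMap κ W 𝔭 S γ n f hf h u hu
  exact ⟨q, ⟨dualLayerMap_injective_of_forall_exists κ W 𝔭 S γ n u hu q hq hsurj,
    dualLayerMap_surjective_of_injective κ W 𝔭 S γ n u hu q hq hinj⟩, hq⟩

/-- **Fitting form of exact control at layer `n`**: `Fitt₀(Hom(Sel_𝔭^Σ(K_n, E[p^∞]), ℚ/ℤ)) = Fitt₀(X ⧸ ω_n X) ⊆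
Fitt₀(X) + (ω_n)` (`X = X_ac^Σ` finitely generated; Stacks 07ZA (3) via the tree's `fittingIdeal_quotient_le_sup`).
[cite: StacksProject, Tag 07ZA (3)] [cite: MazurTate1987, §1] -/
theorem fittingIdeal_layer_le_sup_of_control [Module.Finite (IwasawaAlgebra p) (XAc W p κ 𝔭 S γ)]
    (f : AddMonoid.End ↥(selmerOver (κ.layerSubgroup n) (W.geomPrimaryTorsion p) p 𝔭 S))
    (hf : ∀ s, ((f s : selmerOver (κ.layerSubgroup n) (W.geomPrimaryTorsion p) p 𝔭 S) :
      W.subgroupH1 p (κ.layerSubgroup n)) = W.conjH1 p (κ.layerSubgroup n) γ s)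
    (h : IsLocNil p (f - 1))
    (hinj : Function.Injective (W.resOfLe p (κ.kerSubgroup_le_layerSubgroup n)))
    (hsurj : ∀ a ∈ selmerAc W p κ 𝔭 S, W.conjH1 p κ.kerSubgroup (γ ^ p ^ n) a = a →
      ∃ c ∈ selmerOver (κ.layerSubgroup n) (W.geomPrimaryTorsion p) p 𝔭 S,
        W.resOfLe p (κ.kerSubgroup_le_layerSubgroup n) c = a) :
    Module.fittingIdeal (IwasawaAlgebra p)
        (LocNilDual (selmerOver (κ.layerSubgroup n) (W.geomPrimaryTorsion p) p 𝔭 S) f h) 0 ≤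
      Module.fittingIdeal (IwasawaAlgebra p) (XAc W p κ 𝔭 S γ) 0 ⊔
        Ideal.span {((1 + PowerSeries.X : IwasawaAlgebra p) ^ (p ^ n) - 1)} := by
  -- the canonical `u`
  let u : ↥(selmerOver (κ.layerSubgroup n) (W.geomPrimaryTorsion p) p 𝔭 S) →+ ↥(selmerAc W p κ 𝔭 S) :=
    { toFun := fun c ↦ ⟨W.resOfLe p (κ.kerSubgroup_le_layerSubgroup n) c,
        resOfLe_layer_mem_selmerOver κ n c.2⟩
      map_zero' := Subtype.ext (by simp)
      map_add' := fun a b ↦ Subtype.ext (by simp) }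
  have hu : ∀ c, ((u c : selmerAc W p κ 𝔭 S) : W.subgroupH1 p κ.kerSubgroup) =
      W.resOfLe p (κ.kerSubgroup_le_layerSubgroup n) c := fun _ ↦ rfl
  obtain ⟨q, hqbij, -⟩ := dualLayerMap_bijective_of_control κ W 𝔭 S γ n f hf h u hu hinj hsurj
  let e := LinearEquiv.ofBijective q hqbij
  rw [← Module.fittingIdeal_eq_of_linearEquiv e 0]
  intro r hr
  -- `Fitt₀(X/ω_n X) ⊆ Fitt₀(X) + (ω_n)`
  exact Summit.BirchSwinnertonDyer.BirchSwinnertonDyer.Theorems.BoundedCongruenceLimit.fittingIdeal_quotient_le_sup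
    (Ideal.span {((1 + PowerSeries.X : IwasawaAlgebra p) ^ (p ^ n) - 1)}) (XAc W p κ 𝔭 S γ) 0 hr

end DualMap

/-! ## §4 `Σ`-passage on the dual side: `Fitt₀(X^Σ) ⊆ Fitt₀(X^∅)` -/

section Sigma

variable [hγ : Fact (κ.IsTopGenerator γ)]

/-- **`X_ac^∅` is a `Λ`-quotient of `X_ac^Σ`**: restriction of characters along `Sel_𝔭 ⊆ Sel_𝔭^Σ` is a SURJECTIVE
`Λ`-linear map `X_ac^Σ → X_ac^∅` (`ℚ/ℤ` injective; the inclusion commutes with `conj_γ`). [cite: Castella2018, Def. 2.2 (arXiv:1704.06608 p. 5)] -/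
theorem exists_surjective_XAc_to_empty :
    ∃ π : XAc W p κ 𝔭 S γ →ₗ[IwasawaAlgebra p] XAc W p κ 𝔭 ∅ γ,
      Function.Surjective π ∧ ∀ (x : XAc W p κ 𝔭 S γ) (s : selmerAc W p κ 𝔭 ∅),
        π x s = x ⟨s, selmerAc_empty_le s.2⟩ := by
  let ι : ↥(selmerAc W p κ 𝔭 ∅) →+ ↥(selmerAc W p κ 𝔭 S) := AddSubgroup.inclusion selmerAc_empty_le
  have hι : ∀ t, (conjSelmerAc W p κ 𝔭 S γ - 1) (ι t) = ι ((conjSelmerAc W p κ 𝔭 ∅ γ - 1) t) :=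
    fun t ↦ by
      apply Subtype.ext
      simp only [ι, IwasawaDual.End_sub_apply, AddMonoid.End.one_apply, AddSubgroup.coe_sub,
        coe_conjSelmerAc_apply, AddSubgroup.coe_inclusion]
  let π : XAc W p κ 𝔭 S γ →ₗ[IwasawaAlgebra p] XAc W p κ 𝔭 ∅ γ :=
    { toFun := fun x ↦ (show selmerAc W p κ 𝔭 S →+ AddCircle (1 : ℚ) from x).comp ι
      map_add' := fun _ _ ↦ rfl
      map_smul' := fun F x ↦ by
        change ((isLocNil_conjSelmerAc_sub_one W p κ 𝔭 S hγ.out).smulFun F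
            (show selmerAc W p κ 𝔭 S →+ AddCircle (1 : ℚ) from x)).comp ι =
          (isLocNil_conjSelmerAc_sub_one W p κ 𝔭 ∅ hγ.out).smulFun F
            ((show selmerAc W p κ 𝔭 S →+ AddCircle (1 : ℚ) from x).comp ι)
        exact Summit.BirchSwinnertonDyer.Rank1Residual.X2.DualRestriction.smulFun_comp
          (isLocNil_conjSelmerAc_sub_one W p κ 𝔭 S hγ.out)
          (isLocNil_conjSelmerAc_sub_one W p κ 𝔭 ∅ hγ.out) ι hι F _ }
  have hπ : ∀ (x : XAc W p κ 𝔭 S γ) (s : selmerAc W p κ 𝔭 ∅), π x s = x ⟨s, selmerAc_empty_le s.2⟩ :=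
    fun x s ↦ by
      -- (no `rfl` across `X_ac^∅`/`X_ac^Σ`-typed coercions: the kernel would compare `Sel^∅` with `Sel^Σ`)
      show ((show selmerAc W p κ 𝔭 S →+ AddCircle (1 : ℚ) from x).comp ι) s = _
      rw [AddMonoidHom.comp_apply]
      rfl
  refine ⟨π, fun y ↦ ?_, hπ⟩
  -- every character of `Sel^∅` extends along the injective `ι` (`ℚ/ℤ` divisible)
  obtain ⟨χ, hχ⟩ := CharacterModule.dual_surjective_of_injective ι.toIntLinearMap
    (AddSubgroup.inclusion_injective selmerAc_empty_le)
    (show selmerAc W p κ 𝔭 ∅ →+ AddCircle (1 : ℚ) from y)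
  refine ⟨(show XAc W p κ 𝔭 S γ from χ), ?_⟩
  apply AddMonoidHom.ext
  intro s
  exact (hπ _ s).trans (DFunLike.congr_fun hχ s)

/-- **`Fitt₀(X_ac^Σ) ⊆ Fitt₀(X_ac^∅)`** (Stacks 07ZA (3) along the surjection): an (LT)-type membership proved with the
bad-imprimitive Selmer groups (exact control, III) implies the one for K1's own `X_{∅}`. [cite: StacksProject, Tag 07ZA (3)] -/
theorem fittingIdeal_XAc_le_empty :
    Module.fittingIdeal (IwasawaAlgebra p) (XAc W p κ 𝔭 S γ) 0 ≤
      Module.fittingIdeal (IwasawaAlgebra p) (XAc W p κ 𝔭 ∅ γ) 0 := by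
  obtain ⟨π, hπ, -⟩ := exists_surjective_XAc_to_empty κ W 𝔭 S γ
  exact Module.fittingIdeal_le_of_surjective π hπ 0

end Sigma

end Summit.BirchSwinnertonDyer.BirchSwinnertonDyer.Theorems.CumulativeHeegnerInclusionAtThreeLayerControlDual

end
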